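import Mathlib.RingTheory.Ideal.Operations
import Mathlib.Tactic.Ring
import Mathlib.Tactic.LinearCombination

set_option linter.dupNamespace false -- the summit's canonical namespace repeats `ResolutionOfSingularities` (crit N1)

/-!
# Lens 5 (transfer from the solved sibling), g19 — (QK1): Hironaka-permissible curve centres of the
# small-multiplicity phase of `X^p = G` whose base image is SINGULAR (kernel certificates for the explicit examples)

Crux `stmt-ResolutionOfSingularities-0549` (`Theses.Descent.DescentPerfectToAll`), slot `via_clean_models` ⟸
`stmt-15917` (`Theses.RadicialJung.CleanModels`), research residual `stub_cleanLU3DefectNonDiscrete` at ODD `p`.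
Companion memo: `Cruxes/DescentPerfectToAll/ODDP-QK1-small-mult-centres-lens5-g19.md` (Theorems A, B, B1, B2, C, C′, 1, 2 and
the consequences for the base-side reading «Q-Krat» of `ODDP-structure-lens5-g8.md` §4).  LABEL: bears_on LADDER-RESOLUTION:B ·
[OURS · CANDIDATE] counted 0; nothing here proves resolution in characteristic `p`; nothing is claimed for the crux.

WHAT IS CERTIFIED HERE (pure commutative algebra, any commutative ring `R`; 35 theorems, 0 sorry):

* MONIC (entry) frame `h = X^p − G` (sections `Eleven`, `Thirteen`, `Further`):
  `taylor_identity_eleven` / `taylor_identity_thirteen`: the integer polynomial identities expressing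
  `h = X^p − G` (`p = 11`, `G = u₃² + 7u₁⁴u₂ + 5u₁u₂³`; `p = 13`, `G = u₃² + 6u₁²u₂³ + 8u₁⁵u₂`) as
  `−u₃² − Q(u₁ − X², u₂ − X³) − p·D` with `Q` in the square of the ideal `(u₁ − X², u₂ − X³)`;
  `mem_sq_eleven` / `mem_sq_thirteen`: hence, in characteristic `p`, `h ∈ I²` for every ideal `I ∋ u₃, u₁ − X², u₂ − X³` —
  in `Z = Spec k[u₁,u₂,u₃,X]` this is `ord_Y(h) ≥ 2` along the REGULAR curve `Y = {(t²,t³,0,t)}` (the graph of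
  `t ↦ (t², t³, 0)` over the `X`-line), whose image in the base `Spec k[u₁,u₂,u₃]` is the CUSP `{u₃ = 0, u₁³ = u₂²}`;
  `curve_in_sing_eleven` / `sing_on_curve_eleven` (+ `cusp_param`): over any field of characteristic `11`, the common
  zeros of `h, ∂h/∂u₁, ∂h/∂u₂, ∂h/∂u₃` (`∂h/∂X = 11X¹⁰ ≡ 0`) are EXACTLY the points `(t², t³, 0, t)`; by the Jacobian
  criterion (informal, standard) `Sing(𝒳) = Sing₂(𝒳) = Y` as sets, and `Sing₃(𝒳) = ∅` since the degree-two part of `h`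
  at every point of `Y` contains `−U₃²` — so `Y` is the whole (regular, one-dimensional) top Samuel stratum of `𝒳`,
  `𝒳` is normally flat along `Y`, and `Y` is the canonical Hironaka centre; its base image is the cusp;
  `taylor_identity_nineteen_e3` / `mem_pow_nineteen_e3`: `p = 19`, `m = 2`, `G = u₃² + 6u₁u₂⁴ + 14u₁⁵u₂`,
  `h ∈ I²` for `I ∋ u₃, u₁ − X³, u₂ − X⁴` — a permissible curve whose base image is the plane branch `u₂³ = u₁⁴` of
  multiplicity THREE; `taylor_identity_seventeen_m3` / `mem_pow_seventeen_m3`: `p = 17`, `m = 3`,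
  `G = u₃³ + 11u₁u₂⁵ + 3u₁⁴u₂³ + 4u₁⁷u₂`, `h ∈ I³` for `I ∋ u₃, u₁ − X², u₂ − X³` — a permissible curve through a point of
  multiplicity THREE over the cusp (memo Theorem C: `17 = 2·7+3 = 2·4+9 = 2·1+15` has three representations; the
  coefficients `4, 3, 11` are the Lagrange weights of the node `0` against `7, 4, 1` in `𝔽₁₇`).
* ONE POINT BLOWING UP LATER, frame `h₁ = u₁^(p−m') · X^p − G₁` (section `PostBlowup`; memo Theorems C′ and 2):
  `taylor_identity_five_post` / `mem_sq_five_post`: `p = 5`, `m' = 2`: `u₁³X⁵ − (u₃² + 2u₁u₂³ + 4u₁⁴u₂) ∈ I²` for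
  `I ∋ u₃, u₁ − X², u₂ − X³`; `taylor_identity_seven_post` / `mem_sq_seven_post`: `p = 7`, `m' = 2`:
  `u₁⁵X⁷ − (u₃² + 3u₁⁴u₂³ + 5u₁⁷u₂) ∈ I²` likewise. Here `G₁` is the strict transform, in the `u₁`-chart of the blowing up
  of the closed point, of the monic stage `X''^5 = u₃² + 2u₂³ + 4u₁⁵u₂` resp. `X''^7 = u₃² + 3u₁³u₂³ + 5u₁⁸u₂` (multiplicity
  `m' = 2 < p`), and the origin of that chart is the centre of the monomial valuation with `μ(u₁,u₂,u₃) = (1,2,4)`: so at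
  `p = 5` and `p = 7` a permissible curve over the CUSP of the new base appears one permissible step after the entry stage.
* `p = 3`, ONE PERMISSIBLE CURVE BLOWING UP LATER (section `ThreePost`; memo Theorem 2): `taylor_identity_three_post` /
  `mem_sq_three_post`: `u₁X³ − (u₂² + 2u₁² + 2u₃³) ∈ I²` for `I ∋ u₂, u₁ − X³, u₃ − X²`; `curve_in_sing_three_post` /
  `sing_on_curve_three_post`: over any field of characteristic `3` the common zeros of `h₁, ∂h₁/∂u₁, ∂h₁/∂u₂` are EXACTLY the
  points `(t³, 0, t², t)` — so `Sing(𝒳₁) = Sing₂(𝒳₁) = Y₁` is a regular curve over the cusp `u₁² = u₃³` and the CANONICAL centre.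
  Here `h₁` is the strict transform, in the `u₁`-chart of the blowing up of the permissible curve `V(u₁,u₂,X'')` (regular base
  image), of the monic entry stage `X''³ = u₂² + 2u₁⁴ + 2u₁²u₃³`, and the chart origin is the centre of `μ(u₁,u₂,u₃) = (1,2,1)`.
* CANONICAL second-stage examples at `p = 5, 7` (section `CanonicalFiveSeven`; memo Theorem 2, canonical variants; `|M| = 1`
  so the fibre line is NOT in `Sing₂`): `taylor_identity_five_canon` / `mem_sq_five_canon`: `u₁X⁵ − (u₃² + 3u₁²u₂ + 3u₂⁴) ∈ I²`
  for `I ∋ u₃, u₁ − X³, u₂ − X²`; `curve_in_sing_five_canon` / `sing_on_curve_five_canon`: in characteristic `5` the common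
  zeros of `h₁` and its `u`-partials are EXACTLY the points `(t³, t², 0, t)` — `Sing(𝒳₁) = Sing₂ = Y₁` over the cusp
  `u₁² = u₂³`; `h₁` is the `u₁`-chart strict transform (point blown up, `μ = (1,2,2)`) of the monic stage
  `X''⁵ = u₁²u₃² + 3u₁⁵u₂ + 3u₂⁴` of multiplicity `4`. Likewise `taylor_identity_seven_canon` / `mem_sq_seven_canon` /
  `curve_in_sing_seven_canon` / `sing_on_curve_seven_canon`: `p = 7`, `u₁X⁷ − (u₃² + 5u₁³u₂ + 3u₂³) ∈ I²` for
  `I ∋ u₃, u₁ − X², u₂ − X³`, `Sing = Y₁ = {(t²,t³,0,t)}`, from the monic stage `X''⁷ = u₁⁴u₃² + 5u₁⁸u₂ + 3u₁³u₂³` of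
  multiplicity `6`. (All curves of `PostBlowup`, `ThreePost`, `CanonicalFiveSeven` are TANGENT to the exceptional divisor
  `V(u₁)` — Hironaka-permissible, not B-permissible; memo §5ter.)
* WITH BOUNDARY (section `Boundary`; memo §5ter, Theorem 3 / Corollary 3.1 / Theorem 4): curves INSIDE the exceptional
  divisor `E₁ = V(u₁)` (normal crossings with the boundary hold): `mem_sq_five_inE`: `u₁X⁵ − (u₁² + u₁u₂u₃ + (u₃³ − u₂²)²) ∈ I²`
  for `I ∋ u₁, u₂ − X³, u₃ − X²` (characteristic-free) — `Y = {(0,t³,t²,t)} ⊂ E₁` over the cusp of the exceptional plane, the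
  strict transform (curve `V(u₁,u₂,X'')` blown up, `μ = (1,2,1)`) of the multiplicity-`4` monic stage
  `X''⁵ = u₁⁶ + u₁⁴u₂u₃ + (u₁²u₃³ − u₂²)²`; `mem_sq_seven_inE`: `u₁X⁷ − (u₁² + u₁u₂²u₃ + (u₂³ − u₃²)²) ∈ I²` for
  `I ∋ u₁, u₂ − X², u₃ − X³`, from the multiplicity-`6` monic stage `X''⁷ = u₁⁸ + u₁⁴u₂²u₃ + (u₂³ − u₁u₃²)²` (point blown
  up, `μ = (1,2,2)`); `sing_on_curve_five_inE` / `sing_on_curve_seven_inE` (converses, over fields of characteristic `5` / `7`,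
  near the chart origin `u₃ ≠ 1` / `u₂ ≠ 2`): the common zeros of `h₁` and its three base partials (`∂h₁/∂X ≡ 0`) are EXACTLY
  the points of `Y` — so `Sing(𝒳₁) = Y` near `x₁`: the B-permissible curve with cuspidal base image is the whole singular locus
  of its stage (memo Cor. 3.1, R1′). And the `p = 3` INSEPARABLE-MULTISECTION stage (memo Theorem 4): `mem_sq_three_ms_entry` /
  `sing_three_ms_entry`: the entry stage `X³ = u₂² + u₁³u₃` has `h ∈ I²` for `I ∋ u₁, u₂, X` and, in characteristic `3`,
  singular locus exactly `V(u₁, u₂, X)` (a Q-Krat curve over the `u₃`-axis); `mem_sq_three_ms` / `sing_three_ms`: its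
  `u₁`-chart transform `h₁ = u₁X³ − (u₂² + u₁u₃)` has `h₁ ∈ I²` for `I ∋ u₁, u₂, X³ − u₃` and singular locus exactly
  `V(u₁, u₂, X³ − u₃)` — a regular curve inside `E₁`, purely inseparable of degree `3` over the regular `u₃`-axis: the canonical
  B-permissible centre is not `V(u_J, X − c)`-shaped (but its blowing up is the base blowing up of the axis, memo Theorem 4).

Together (memo §4–§5ter): `Y` is regular, `h ∈ I_Y^m` with `m = ord_x h < p` — a Hironaka-permissible curve centre of the
small-multiplicity phase of the purely inseparable hypersurface `X^p = G` (resp. `u₁^c X^p = G₁`) whose base image is NOT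
regular; the blowing up along `Y` is not the base change of a blowing up of a regular centre of the base in ANY chart (the
K-rational «sandwich» frame is lost at such a step, independently of where the valuation's centre goes).  Memo Theorem 1: in the
MONIC frame this cannot happen for `p ∈ {3, 5, 7}` (and never when `m·e > p`, `e` = multiplicity of the base image) and happens,
canonically, for every `p ≥ 11`; memo Theorem 2: one permissible Q-Krat-shaped move later it happens for EVERY odd `p` — canonically
at `p = 3` (curve move; `Sing₂ = Y₁`) and in the `CanonicalFiveSeven` examples at `p = 5, 7`.  (QK1) is an entry-stage property of
`p ≤ 7`, not an invariant of Hironaka-permissible procedures at any odd `p`.  WITH BOUNDARY (memo §5ter): singular base images of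
B-permissible centres need previous centres of multiplicity `≥ 4` (curves) / `≥ 6` (points) — never at `p = 3`, attained at
`p = 5, 7` (`Boundary`: there `Sing(𝒳₁)` IS the singular-image curve); at `p = 3` the remaining non-Q-Krat centres are inseparable
multisections over REGULAR base curves.
-/

namespace Summit.ResolutionOfSingularities.ResolutionOfSingularities.Cruxes.DescentPerfectToAll.Lens5.QK1

section Eleven

variable {R : Type*} [CommRing R]

/-- `p = 11`: Taylor expansion of `G₀ = 7u₁⁴u₂ + 5u₁u₂³` along the cusp parametrisation `(X², X³)`, as an INTEGER identity:
the constant term is `12·X¹¹ = X¹¹ + 11·X¹¹`, the linear terms are `33X⁹·v₁ + 22X⁸·v₂` (multiples of `11`), `v₁ = u₁ − X²`,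
`v₂ = u₂ − X³`. [folklore] -/
theorem taylor_identity_eleven (u₁ u₂ u₃ X : R) :
    X ^ 11 - (u₃ ^ 2 + 7 * u₁ ^ 4 * u₂ + 5 * u₁ * u₂ ^ 3) =
      -(u₃ ^ 2)
        - ((42 * X ^ 7 + 42 * (u₂ - X ^ 3) * X ^ 4 + 28 * (u₁ - X ^ 2) * X ^ 5
              + 28 * (u₁ - X ^ 2) * (u₂ - X ^ 3) * X ^ 2 + 7 * (u₁ - X ^ 2) ^ 2 * X ^ 3
              + 7 * (u₁ - X ^ 2) ^ 2 * (u₂ - X ^ 3)) * (u₁ - X ^ 2) ^ 2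
            + (43 * X ^ 6 + 15 * (u₂ - X ^ 3) * X ^ 3 + 5 * (u₂ - X ^ 3) ^ 2) * (u₁ - X ^ 2) * (u₂ - X ^ 3)
            + (15 * X ^ 5 + 5 * (u₂ - X ^ 3) * X ^ 2) * (u₂ - X ^ 3) ^ 2)
        - 11 * (X ^ 11 + 3 * X ^ 9 * (u₁ - X ^ 2) + 2 * X ^ 8 * (u₂ - X ^ 3)) := by
  ring

/-- `p = 11`, characteristic `11`: `h = X¹¹ − (u₃² + 7u₁⁴u₂ + 5u₁u₂³)` lies in `I²` for every ideal `I` containing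
`u₃`, `u₁ − X²`, `u₂ − X³` (the ideal of the regular curve `Y = {(t², t³, 0, t)}` when these generate it). [folklore] -/
theorem mem_sq_eleven (h11 : (11 : R) = 0) (u₁ u₂ u₃ X : R) (I : Ideal R)
    (h₃ : u₃ ∈ I) (h₁ : u₁ - X ^ 2 ∈ I) (h₂ : u₂ - X ^ 3 ∈ I) :
    X ^ 11 - (u₃ ^ 2 + 7 * u₁ ^ 4 * u₂ + 5 * u₁ * u₂ ^ 3) ∈ I ^ 2 := by
  rw [taylor_identity_eleven, h11, zero_mul, sub_zero, pow_two I]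
  have hv₃ : u₃ ^ 2 ∈ I * I := by rw [pow_two]; exact Ideal.mul_mem_mul h₃ h₃
  have hv₁ : (u₁ - X ^ 2) ^ 2 ∈ I * I := by rw [pow_two]; exact Ideal.mul_mem_mul h₁ h₁
  have hv₂ : (u₂ - X ^ 3) ^ 2 ∈ I * I := by rw [pow_two]; exact Ideal.mul_mem_mul h₂ h₂
  have hA : (42 * X ^ 7 + 42 * (u₂ - X ^ 3) * X ^ 4 + 28 * (u₁ - X ^ 2) * X ^ 5
              + 28 * (u₁ - X ^ 2) * (u₂ - X ^ 3) * X ^ 2 + 7 * (u₁ - X ^ 2) ^ 2 * X ^ 3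
              + 7 * (u₁ - X ^ 2) ^ 2 * (u₂ - X ^ 3)) * (u₁ - X ^ 2) ^ 2 ∈ I * I :=
    Ideal.mul_mem_left _ _ hv₁
  have hB : (43 * X ^ 6 + 15 * (u₂ - X ^ 3) * X ^ 3 + 5 * (u₂ - X ^ 3) ^ 2) * (u₁ - X ^ 2) * (u₂ - X ^ 3)
      ∈ I * I :=
    Ideal.mul_mem_mul (Ideal.mul_mem_left _ _ h₁) h₂
  have hC : (15 * X ^ 5 + 5 * (u₂ - X ^ 3) * X ^ 2) * (u₂ - X ^ 3) ^ 2 ∈ I * I :=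
    Ideal.mul_mem_left _ _ hv₂
  exact (I * I).sub_mem ((I * I).neg_mem hv₃) ((I * I).add_mem ((I * I).add_mem hA hB) hC)

/-- Parametrisation of the cuspidal cubic over a field: `u₂² = u₁³ ⟹ (u₁, u₂) = (t², t³)` with `t = u₂/u₁` (or `0`).
[folklore] -/
theorem cusp_param {K : Type*} [Field K] (u₁ u₂ : K) (h : u₂ ^ 2 = u₁ ^ 3) :
    ∃ t : K, u₁ = t ^ 2 ∧ u₂ = t ^ 3 := by
  by_cases h1 : u₁ = 0
  · subst h1
    have h2 : u₂ = 0 := (pow_eq_zero_iff (two_ne_zero)).mp (by simpa using h)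
    exact ⟨0, by simp, by simp [h2]⟩
  · have e1 : (u₂ / u₁) ^ 2 = u₁ := by
      rw [div_pow, h, pow_succ, mul_comm, mul_div_assoc, div_self (pow_ne_zero 2 h1), mul_one]
    refine ⟨u₂ / u₁, e1.symm, ?_⟩
    rw [pow_succ, e1, ← mul_div_assoc, mul_comm u₁ u₂, mul_div_assoc, div_self h1, mul_one]

/-- `p = 11`, characteristic `11`: every point `(t², t³, 0, t)` of the curve `Y` is a common zero of
`h = X¹¹ − G`, `∂h/∂u₁ = −(28u₁³u₂ + 5u₂³)`, `∂h/∂u₂ = −(7u₁⁴ + 15u₁u₂²)`, `∂h/∂u₃ = −2u₃` (and `∂h/∂X = 11X¹⁰ ≡ 0`):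
`Y ⊆ Sing(𝒳)` by the Jacobian criterion. [folklore] -/
theorem curve_in_sing_eleven (h11 : (11 : R) = 0) (t : R) :
    (t ^ 11 - ((0 : R) ^ 2 + 7 * (t ^ 2) ^ 4 * t ^ 3 + 5 * t ^ 2 * (t ^ 3) ^ 3) = 0)
    ∧ (28 * (t ^ 2) ^ 3 * t ^ 3 + 5 * (t ^ 3) ^ 3 = 0)
    ∧ (7 * (t ^ 2) ^ 4 + 15 * t ^ 2 * (t ^ 3) ^ 2 = 0)
    ∧ (2 * (0 : R) = 0) := by
  refine ⟨?_, ?_, ?_, by simp⟩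
  · linear_combination (-(t ^ 11)) * h11
  · linear_combination (3 * t ^ 9) * h11
  · linear_combination (2 * t ^ 8) * h11

/-- `p = 11`, over any FIELD of characteristic `11`: conversely every common zero of `h, ∂h/∂u₁, ∂h/∂u₂, ∂h/∂u₃` lies on
`Y = {(t², t³, 0, t)}`.  With `curve_in_sing_eleven`: `Sing(𝒳) = Y` as sets (Jacobian criterion), a regular curve whose
base image `{u₃ = 0, u₂² = u₁³}` is the cuspidal cubic; `Sing₃(𝒳) = ∅` (the quadratic part `−U₃²` never vanishes), so
`Y = Sing₂(𝒳)` is the whole top multiplicity stratum and — `𝒳` being a hypersurface equimultiple along the regular `Y` —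
a Hironaka-permissible (indeed the canonical) centre. [folklore] -/
theorem sing_on_curve_eleven {K : Type*} [Field K] (h11 : (11 : K) = 0) (u₁ u₂ u₃ X : K)
    (hh : X ^ 11 - (u₃ ^ 2 + 7 * u₁ ^ 4 * u₂ + 5 * u₁ * u₂ ^ 3) = 0)
    (hd₁ : 28 * u₁ ^ 3 * u₂ + 5 * u₂ ^ 3 = 0) (hd₂ : 7 * u₁ ^ 4 + 15 * u₁ * u₂ ^ 2 = 0)
    (hd₃ : 2 * u₃ = 0) :
    ∃ t : K, u₁ = t ^ 2 ∧ u₂ = t ^ 3 ∧ u₃ = 0 ∧ X = t := by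
  have hu₃ : u₃ = 0 := by linear_combination 6 * hd₃ - u₃ * h11
  have hcusp : u₂ ^ 2 = u₁ ^ 3 := by
    rcases mul_eq_zero.mp (show u₂ * (28 * u₁ ^ 3 + 5 * u₂ ^ 2) = 0 by linear_combination hd₁) with h0 | hA
    · subst h0
      have h4 : u₁ ^ 4 = 0 := by linear_combination 8 * hd₂ - 5 * u₁ ^ 4 * h11
      have hu₁ : u₁ = 0 := (pow_eq_zero_iff (by norm_num)).mp h4
      subst hu₁
      ring
    · linear_combination 9 * hA - (4 * u₂ ^ 2 + 23 * u₁ ^ 3) * h11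
  obtain ⟨t, ht₁, ht₂⟩ := cusp_param u₁ u₂ hcusp
  refine ⟨t, ht₁, ht₂, hu₃, ?_⟩
  subst ht₁ ht₂ hu₃
  have hX : (X - t) ^ 11 = 0 := by
    linear_combination hh + (t ^ 11 - X ^ 10 * t + 5 * X ^ 9 * t ^ 2 - 15 * X ^ 8 * t ^ 3 + 30 * X ^ 7 * t ^ 4
      - 42 * X ^ 6 * t ^ 5 + 42 * X ^ 5 * t ^ 6 - 30 * X ^ 4 * t ^ 7 + 15 * X ^ 3 * t ^ 8 - 5 * X ^ 2 * t ^ 9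
      + X * t ^ 10) * h11
  exact sub_eq_zero.mp ((pow_eq_zero_iff (by norm_num)).mp hX)

end Eleven

section Thirteen

variable {R : Type*} [CommRing R]

/-- `p = 13`: the analogous INTEGER identity for `G₀ = 6u₁²u₂³ + 8u₁⁵u₂` along `(X², X³)`: constant term
`14·X¹³ = X¹³ + 13·X¹³`, linear terms `52X¹¹·v₁ + 26X¹⁰·v₂`. [folklore] -/
theorem taylor_identity_thirteen (u₁ u₂ u₃ X : R) :
    X ^ 13 - (u₃ ^ 2 + 6 * u₁ ^ 2 * u₂ ^ 3 + 8 * u₁ ^ 5 * u₂) =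
      -(u₃ ^ 2)
        - ((86 * X ^ 9 + 98 * (u₂ - X ^ 3) * X ^ 6 + 18 * (u₂ - X ^ 3) ^ 2 * X ^ 3 + 6 * (u₂ - X ^ 3) ^ 3
              + 80 * (u₁ - X ^ 2) * X ^ 7 + 80 * (u₁ - X ^ 2) * (u₂ - X ^ 3) * X ^ 4
              + 40 * (u₁ - X ^ 2) ^ 2 * X ^ 5 + 40 * (u₁ - X ^ 2) ^ 2 * (u₂ - X ^ 3) * X ^ 2
              + 8 * (u₁ - X ^ 2) ^ 3 * X ^ 3 + 8 * (u₁ - X ^ 2) ^ 3 * (u₂ - X ^ 3)) * (u₁ - X ^ 2) ^ 2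
            + (76 * X ^ 8 + 36 * (u₂ - X ^ 3) * X ^ 5 + 12 * (u₂ - X ^ 3) ^ 2 * X ^ 2) * (u₁ - X ^ 2) * (u₂ - X ^ 3)
            + (18 * X ^ 7 + 6 * (u₂ - X ^ 3) * X ^ 4) * (u₂ - X ^ 3) ^ 2)
        - 13 * (X ^ 13 + 4 * X ^ 11 * (u₁ - X ^ 2) + 2 * X ^ 10 * (u₂ - X ^ 3)) := by
  ring

/-- `p = 13`, characteristic `13`: `h = X¹³ − (u₃² + 6u₁²u₂³ + 8u₁⁵u₂)` lies in `I²` for every ideal `I` containing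
`u₃`, `u₁ − X²`, `u₂ − X³`. [folklore] -/
theorem mem_sq_thirteen (h13 : (13 : R) = 0) (u₁ u₂ u₃ X : R) (I : Ideal R)
    (h₃ : u₃ ∈ I) (h₁ : u₁ - X ^ 2 ∈ I) (h₂ : u₂ - X ^ 3 ∈ I) :
    X ^ 13 - (u₃ ^ 2 + 6 * u₁ ^ 2 * u₂ ^ 3 + 8 * u₁ ^ 5 * u₂) ∈ I ^ 2 := by
  rw [taylor_identity_thirteen, h13, zero_mul, sub_zero, pow_two I]
  have hv₃ : u₃ ^ 2 ∈ I * I := by rw [pow_two]; exact Ideal.mul_mem_mul h₃ h₃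
  have hv₁ : (u₁ - X ^ 2) ^ 2 ∈ I * I := by rw [pow_two]; exact Ideal.mul_mem_mul h₁ h₁
  have hv₂ : (u₂ - X ^ 3) ^ 2 ∈ I * I := by rw [pow_two]; exact Ideal.mul_mem_mul h₂ h₂
  have hA : (86 * X ^ 9 + 98 * (u₂ - X ^ 3) * X ^ 6 + 18 * (u₂ - X ^ 3) ^ 2 * X ^ 3 + 6 * (u₂ - X ^ 3) ^ 3
              + 80 * (u₁ - X ^ 2) * X ^ 7 + 80 * (u₁ - X ^ 2) * (u₂ - X ^ 3) * X ^ 4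
              + 40 * (u₁ - X ^ 2) ^ 2 * X ^ 5 + 40 * (u₁ - X ^ 2) ^ 2 * (u₂ - X ^ 3) * X ^ 2
              + 8 * (u₁ - X ^ 2) ^ 3 * X ^ 3 + 8 * (u₁ - X ^ 2) ^ 3 * (u₂ - X ^ 3)) * (u₁ - X ^ 2) ^ 2 ∈ I * I :=
    Ideal.mul_mem_left _ _ hv₁
  have hB : (76 * X ^ 8 + 36 * (u₂ - X ^ 3) * X ^ 5 + 12 * (u₂ - X ^ 3) ^ 2 * X ^ 2) * (u₁ - X ^ 2) * (u₂ - X ^ 3)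
      ∈ I * I :=
    Ideal.mul_mem_mul (Ideal.mul_mem_left _ _ h₁) h₂
  have hC : (18 * X ^ 7 + 6 * (u₂ - X ^ 3) * X ^ 4) * (u₂ - X ^ 3) ^ 2 ∈ I * I :=
    Ideal.mul_mem_left _ _ hv₂
  exact (I * I).sub_mem ((I * I).neg_mem hv₃) ((I * I).add_mem ((I * I).add_mem hA hB) hC)

end Thirteen

section Further

variable {R : Type*} [CommRing R]

/-!
## Further certificates (res-B-lens-5 g19, second pass): an `e = 3` base image at `p = 19` and an `m = 3` centre at `p = 17`

`p = 19`, `m = 2`: `X ^ 19 = u₃ ^ 2 + 6 u₁ u₂ ^ 4 + 14 u₁ ^ 5 u₂` is of order `≥ 2` along `(t ^ 3, t ^ 4, 0, t)` — base image the space-filling-free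
plane branch `u₂ ^ 3 = u₁ ^ 4` of multiplicity `3` (the two representations `19 = 3·5 + 4·1 = 3·1 + 4·4`).
`p = 17`, `m = 3`: `X ^ 17 = u₃ ^ 3 + 11 u₁ u₂ ^ 5 + 3 u₁ ^ 4 u₂ ^ 3 + 4 u₁ ^ 7 u₂` is of order `≥ 3` along `(t ^ 2, t ^ 3, 0, t)` — a permissible
curve through a point of multiplicity THREE whose base image is the cusp (the three representations `17 = 2·7 + 3 = 2·4 + 9 = 2·1 + 15`,
coefficients = the Lagrange weights of `0` w.r.t. the nodes `7, 4, 1` in `𝔽₁₇`).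
-/

/-- (nineteen_e3) Taylor expansion over `ℤ` of `X ^ 19 - (u₃ ^ 2 + 6 * u₁ * u₂ ^ 4 + 14 * u₁ ^ 5 * u₂ )` along `u₁ = X ^ 3 + v₁`, `u₂ = X ^ 4 + v₂`,
grouped by monomials of degree `2` in `(u₃, v₁, v₂)` plus a multiple of `19`. [folklore] -/
theorem taylor_identity_nineteen_e3 (u₁ u₂ u₃ X : R) :
    X ^ 19 - (u₃ ^ 2 + 6 * u₁ * u₂ ^ 4 + 14 * u₁ ^ 5 * u₂ ) =
      -(u₃ * u₃) - ((140 * X ^ 13 + 140 * (u₂ - X ^ 4) * X ^ 9 + 140 * (u₁ - X ^ 3) * X ^ 10 + 140 * (u₁ - X ^ 3) * (u₂ - X ^ 4) * X ^ 6 + 70 * (u₁ - X ^ 3) ^ 2 * X ^ 7 + 70 * (u₁ - X ^ 3) ^ 2 * (u₂ - X ^ 4) * X ^ 3 + 14 * (u₁ - X ^ 3) ^ 3 * X ^ 4 + 14 * (u₁ - X ^ 3) ^ 3 * (u₂ - X ^ 4)) * (u₁ - X ^ 3) * (u₁ - X ^ 3) + (94 * X ^ 12 + 36 * (u₂ - X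 ^ 4) * X ^ 8 + 24 * (u₂ - X ^ 4) ^ 2 * X ^ 4 + 6 * (u₂ - X ^ 4) ^ 3) * (u₁ - X ^ 3) * (u₂ - X ^ 4) + (36 * X ^ 11 + 24 * (u₂ - X ^ 4) * X ^ 7 + 6 * (u₂ - X ^ 4) ^ 2 * X ^ 3) * (u₂ - X ^ 4) * (u₂ - X ^ 4)) - 19 * (1 * X ^ 19 + 2 * (u₂ - X ^ 4) * X ^ 15 + 4 * (u₁ - X ^ 3) * X ^ 16) := by
  ring

/-- (nineteen_e3) In characteristic `19`: `X ^ 19 - (u₃ ^ 2 + 6 * u₁ * u₂ ^ 4 + 14 * u₁ ^ 5 * u₂ ) ∈ I ^ 2` for every ideal `I ∋ u₃, u₁ - X ^ 3, u₂ - X ^ 4` — the hypersurface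
`X ^ 19 = u₃ ^ 2 + 6 * u₁ * u₂ ^ 4 + 14 * u₁ ^ 5 * u₂ ` has order `≥ 2` along the regular curve `(u₁, u₂, u₃, X) = (t ^ 3, t ^ 4, 0, t)`, whose base image is the
monomial curve `(t ^ 3, t ^ 4, 0)` (singular at the origin). [folklore] -/
theorem mem_pow_nineteen_e3 (h19 : (19 : R) = 0) (u₁ u₂ u₃ X : R) (I : Ideal R)
    (h₃ : u₃ ∈ I) (h₁ : u₁ - X ^ 3 ∈ I) (h₂ : u₂ - X ^ 4 ∈ I) :
    X ^ 19 - (u₃ ^ 2 + 6 * u₁ * u₂ ^ 4 + 14 * u₁ ^ 5 * u₂ ) ∈ I ^ 2 := by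
  rw [taylor_identity_nineteen_e3, h19, zero_mul, sub_zero, pow_two I]
  have hu₃ : u₃ * u₃ ∈ I * I := Ideal.mul_mem_mul h₃ h₃
  have hT0 : (140 * X ^ 13 + 140 * (u₂ - X ^ 4) * X ^ 9 + 140 * (u₁ - X ^ 3) * X ^ 10 + 140 * (u₁ - X ^ 3) * (u₂ - X ^ 4) * X ^ 6 + 70 * (u₁ - X ^ 3) ^ 2 * X ^ 7 + 70 * (u₁ - X ^ 3) ^ 2 * (u₂ - X ^ 4) * X ^ 3 + 14 * (u₁ - X ^ 3) ^ 3 * X ^ 4 + 14 * (u₁ - X ^ 3) ^ 3 * (u₂ - X ^ 4)) * (u₁ - X ^ 3) * (u₁ - X ^ 3) ∈ I * I :=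
    Ideal.mul_mem_mul (Ideal.mul_mem_left _ _ h₁) h₁
  have hT1 : (94 * X ^ 12 + 36 * (u₂ - X ^ 4) * X ^ 8 + 24 * (u₂ - X ^ 4) ^ 2 * X ^ 4 + 6 * (u₂ - X ^ 4) ^ 3) * (u₁ - X ^ 3) * (u₂ - X ^ 4) ∈ I * I :=
    Ideal.mul_mem_mul (Ideal.mul_mem_left _ _ h₁) h₂
  have hT2 : (36 * X ^ 11 + 24 * (u₂ - X ^ 4) * X ^ 7 + 6 * (u₂ - X ^ 4) ^ 2 * X ^ 3) * (u₂ - X ^ 4) * (u₂ - X ^ 4) ∈ I * I :=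
    Ideal.mul_mem_mul (Ideal.mul_mem_left _ _ h₂) h₂
  exact (I * I).sub_mem ((I * I).neg_mem hu₃) ((I * I).add_mem ((I * I).add_mem hT0 hT1) hT2)

/-- (seventeen_m3) Taylor expansion over `ℤ` of `X ^ 17 - (u₃ ^ 3 + 11 * u₁ * u₂ ^ 5 + 3 * u₁ ^ 4 * u₂ ^ 3 + 4 * u₁ ^ 7 * u₂ )` along `u₁ = X ^ 2 + v₁`, `u₂ = X ^ 3 + v₂`,
grouped by monomials of degree `3` in `(u₃, v₁, v₂)` plus a multiple of `17`. [folklore] -/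
theorem taylor_identity_seventeen_m3 (u₁ u₂ u₃ X : R) :
    X ^ 17 - (u₃ ^ 3 + 11 * u₁ * u₂ ^ 5 + 3 * u₁ ^ 4 * u₂ ^ 3 + 4 * u₁ ^ 7 * u₂ ) =
      -(u₃ ^ 2 * u₃) - ((152 * X ^ 11 + 176 * (u₂ - X ^ 3) * X ^ 8 + 36 * (u₂ - X ^ 3) ^ 2 * X ^ 5 + 12 * (u₂ - X ^ 3) ^ 3 * X ^ 2 + 143 * (u₁ - X ^ 2) * X ^ 9 + 149 * (u₁ - X ^ 2) * (u₂ - X ^ 3) * X ^ 6 + 9 * (u₁ - X ^ 2) * (u₂ - X ^ 3) ^ 2 * X ^ 3 + 3 * (u₁ - X ^ 2) * (u₂ - X ^ 3) ^ 3 + 84 * (u₁ - X ^ 2) ^ 2 * X ^ 7 + 84 * (u₁ - X ^ 2) ^ 2 * (u₂ - X ^ 3) * X ^ 4 + 28 * (u₁ - X ^ 2) ^ 3 * X ^ 5 + 28 * (u₁ - X ^ 2) ^ 3 * (u₂ - X ^ 3) * X ^ 2 + 4 * (u₁ - X ^ 2) ^ 4 * X ^ 3 + 4 * (u₁ - X ^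 2) ^ 4 * (u₂ - X ^ 3)) * (u₁ - X ^ 2) ^ 2 * (u₁ - X ^ 2) + (138 * X ^ 10 + 54 * (u₂ - X ^ 3) * X ^ 7 + 18 * (u₂ - X ^ 3) ^ 2 * X ^ 4) * (u₁ - X ^ 2) ^ 2 * (u₂ - X ^ 3) + (146 * X ^ 9 + 122 * (u₂ - X ^ 3) * X ^ 6 + 55 * (u₂ - X ^ 3) ^ 2 * X ^ 3 + 11 * (u₂ - X ^ 3) ^ 3) * (u₁ - X ^ 2) * (u₂ - X ^ 3) * (u₂ - X ^ 3) + (113 * X ^ 8 + 55 * (u₂ - X ^ 3) * X ^ 5 + 11 * (u₂ - X ^ 3) ^ 2 * X ^ 2) * (u₂ - X ^ 3) ^ 2 * (u₂ - X ^ 3)) - 17 * (1 * X ^ 17 + 4 * (u₂ - X ^ 3) * X ^ 14 + 7 * (u₂ - X ^ 3) ^ 2 * X ^ 11 + 3 * (u₁ - X ^ 2) * X ^ 15 + 7 * (u₁ - X ^ 2) * (u₂ - X ^ 3) * X ^ 12 + 6 * (u₁ - X ^ 2) ^ 2 * X ^ 13) := by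
  ring

/-- (seventeen_m3) In characteristic `17`: `X ^ 17 - (u₃ ^ 3 + 11 * u₁ * u₂ ^ 5 + 3 * u₁ ^ 4 * u₂ ^ 3 + 4 * u₁ ^ 7 * u₂ ) ∈ I ^ 3` for every ideal `I ∋ u₃, u₁ - X ^ 2, u₂ - X ^ 3` — the hypersurface
`X ^ 17 = u₃ ^ 3 + 11 * u₁ * u₂ ^ 5 + 3 * u₁ ^ 4 * u₂ ^ 3 + 4 * u₁ ^ 7 * u₂ ` has order `≥ 3` along the regular curve `(u₁, u₂, u₃, X) = (t ^ 2, t ^ 3, 0, t)`, whose base image is the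
monomial curve `(t ^ 2, t ^ 3, 0)` (singular at the origin). [folklore] -/
theorem mem_pow_seventeen_m3 (h17 : (17 : R) = 0) (u₁ u₂ u₃ X : R) (I : Ideal R)
    (h₃ : u₃ ∈ I) (h₁ : u₁ - X ^ 2 ∈ I) (h₂ : u₂ - X ^ 3 ∈ I) :
    X ^ 17 - (u₃ ^ 3 + 11 * u₁ * u₂ ^ 5 + 3 * u₁ ^ 4 * u₂ ^ 3 + 4 * u₁ ^ 7 * u₂ ) ∈ I ^ 3 := by
  rw [taylor_identity_seventeen_m3, h17, zero_mul, sub_zero, show I ^ 3 = I ^ 2 * I from pow_succ I 2]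
  have hu₃ : u₃ ^ 2 * u₃ ∈ I ^ 2 * I := Ideal.mul_mem_mul (Ideal.pow_mem_pow h₃ 2) h₃
  have hT0 : (152 * X ^ 11 + 176 * (u₂ - X ^ 3) * X ^ 8 + 36 * (u₂ - X ^ 3) ^ 2 * X ^ 5 + 12 * (u₂ - X ^ 3) ^ 3 * X ^ 2 + 143 * (u₁ - X ^ 2) * X ^ 9 + 149 * (u₁ - X ^ 2) * (u₂ - X ^ 3) * X ^ 6 + 9 * (u₁ - X ^ 2) * (u₂ - X ^ 3) ^ 2 * X ^ 3 + 3 * (u₁ - X ^ 2) * (u₂ - X ^ 3) ^ 3 + 84 * (u₁ - X ^ 2) ^ 2 * X ^ 7 + 84 * (u₁ - X ^ 2) ^ 2 * (u₂ - X ^ 3) * X ^ 4 + 28 * (u₁ - X ^ 2) ^ 3 * X ^ 5 + 28 * (u₁ - X ^ 2) ^ 3 * (u₂ - X ^ 3) * X ^ 2 + 4 * (u₁ - X ^ 2) ^ 4 * X ^ 3 + 4 * (u₁ - X ^ 2) ^ 4 * (u₂ - X ^ 3)) * (u₁ - X ^ 2) ^ 2 * (u₁ - X ^ 2) ∈ I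 ^ 2 * I :=
    Ideal.mul_mem_mul (Ideal.mul_mem_left _ _ (Ideal.pow_mem_pow h₁ 2)) h₁
  have hT1 : (138 * X ^ 10 + 54 * (u₂ - X ^ 3) * X ^ 7 + 18 * (u₂ - X ^ 3) ^ 2 * X ^ 4) * (u₁ - X ^ 2) ^ 2 * (u₂ - X ^ 3) ∈ I ^ 2 * I :=
    Ideal.mul_mem_mul (Ideal.mul_mem_left _ _ (Ideal.pow_mem_pow h₁ 2)) h₂
  have hT2 : (146 * X ^ 9 + 122 * (u₂ - X ^ 3) * X ^ 6 + 55 * (u₂ - X ^ 3) ^ 2 * X ^ 3 + 11 * (u₂ - X ^ 3) ^ 3) * (u₁ - X ^ 2) * (u₂ - X ^ 3) * (u₂ - X ^ 3) ∈ I ^ 2 * I :=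
    Ideal.mul_mem_mul ((by rw [pow_two I]; exact Ideal.mul_mem_mul (Ideal.mul_mem_left _ _ h₁) h₂)) h₂
  have hT3 : (113 * X ^ 8 + 55 * (u₂ - X ^ 3) * X ^ 5 + 11 * (u₂ - X ^ 3) ^ 2 * X ^ 2) * (u₂ - X ^ 3) ^ 2 * (u₂ - X ^ 3) ∈ I ^ 2 * I :=
    Ideal.mul_mem_mul (Ideal.mul_mem_left _ _ (Ideal.pow_mem_pow h₂ 2)) h₂
  exact (I ^ 2 * I).sub_mem ((I ^ 2 * I).neg_mem hu₃) ((I ^ 2 * I).add_mem ((I ^ 2 * I).add_mem ((I ^ 2 * I).add_mem hT0 hT1) hT2) hT3)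


end Further

section PostBlowup

/-! ### One step later (memo §5bis): the NON-MONIC frame `u₁^c · X^p = G₁`
After blowing up the closed point of a monic stage `X''^p = G''` of multiplicity `m' < p`, the `u₁`-chart carries
`h₁ = u₁^(p−m') X^p − G₁` with `G₁` the strict transform of `G''`.  For `p = 5` and `p = 7` (where the monic frame admits NO
singular-image permissible curve, memo Theorem 1(a)) such curves appear at this very next stage: the two certificates below. -/

variable {R : Type*} [CommRing R]

/-- (five_post) NON-MONIC frame `u₁ ^ 3 * X ^ 5 = G₁` (the `u₁`-chart one point blow-up after a monic stage of
multiplicity `m' = 2`): Taylor expansion over `ℤ` of `u₁ ^ 3 * X ^ 5 - (u₃ ^ 2 + 2 * u₁ * u₂ ^ 3 + 4 * u₁ ^ 4 * u₂)` along `u₁ = X ^ 2 + v₁`, `u₂ = X ^ 3 + v₂`, grouped by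
monomials of degree `2` in `(u₃, v₁, v₂)` plus a multiple of `5`. [folklore] -/
theorem taylor_identity_five_post (u₁ u₂ u₃ X : R) :
    u₁ ^ 3 * X ^ 5 - (u₃ ^ 2 + 2 * u₁ * u₂ ^ 3 + 4 * u₁ ^ 4 * u₂) =
      -(u₃ * u₃) + ((-21 * X ^ 7 - 24 * (u₂ - X ^ 3) * X ^ 4 - 15 * (u₁ - X ^ 2) * X ^ 5 - 16 * (u₁ - X ^ 2) * (u₂ - X ^ 3) * X ^ 2 - 4 * (u₁ - X ^ 2) ^ 2 * X ^ 3 - 4 * (u₁ - X ^ 2) ^ 2 * (u₂ - X ^ 3)) * (u₁ - X ^ 2) * (u₁ - X ^ 2) + (-22 * X ^ 6 - 6 * (u₂ - X ^ 3) * X ^ 3 - 2 * (u₂ - X ^ 3) ^ 2) * (u₁ - X ^ 2) * (u₂ - X ^ 3) + (-6 * X ^ 5 - 2 * (u₂ - X ^ 3) * X ^ 2) * (u₂ - X ^ 3) * (u₂ - X ^ 3)) + 5 * (-1 * X ^ 11 - 2 * (u₂ - X ^ 3) * X ^ 8 - 3 * (u₁ - X ^ 2) * X ^ 9) := by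
  ring

/-- (five_post) In characteristic `5`: `u₁ ^ 3 * X ^ 5 - (u₃ ^ 2 + 2 * u₁ * u₂ ^ 3 + 4 * u₁ ^ 4 * u₂) ∈ I ^ 2` for every ideal `I ∋ u₃, u₁ - X ^ 2, u₂ - X ^ 3`:
the hypersurface `u₁ ^ 3 * X ^ 5 = u₃ ^ 2 + 2 * u₁ * u₂ ^ 3 + 4 * u₁ ^ 4 * u₂` (reached from the monic stage `X''^5 = u₁^2·G₁(u₁,u₂/u₁,u₃/u₁)` by
blowing up the closed point, `u₁`-chart) has order `≥ 2` along the regular curve `(t ^ 2, t ^ 3, 0, t)`, whose image in the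
NEW base `Spec k[u₁,u₂,u₃]` is the singular monomial curve `(t ^ 2, t ^ 3, 0)`. [folklore] -/
theorem mem_sq_five_post (h5 : (5 : R) = 0) (u₁ u₂ u₃ X : R) (I : Ideal R)
    (h₃ : u₃ ∈ I) (h₁ : u₁ - X ^ 2 ∈ I) (h₂ : u₂ - X ^ 3 ∈ I) :
    u₁ ^ 3 * X ^ 5 - (u₃ ^ 2 + 2 * u₁ * u₂ ^ 3 + 4 * u₁ ^ 4 * u₂) ∈ I ^ 2 := by
  rw [taylor_identity_five_post, h5, zero_mul, add_zero, pow_two I]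
  have hu₃ : u₃ * u₃ ∈ I * I := Ideal.mul_mem_mul h₃ h₃
  have hT0 : (-21 * X ^ 7 - 24 * (u₂ - X ^ 3) * X ^ 4 - 15 * (u₁ - X ^ 2) * X ^ 5 - 16 * (u₁ - X ^ 2) * (u₂ - X ^ 3) * X ^ 2 - 4 * (u₁ - X ^ 2) ^ 2 * X ^ 3 - 4 * (u₁ - X ^ 2) ^ 2 * (u₂ - X ^ 3)) * (u₁ - X ^ 2) * (u₁ - X ^ 2) ∈ I * I :=
    Ideal.mul_mem_mul (Ideal.mul_mem_left _ _ h₁) h₁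
  have hT1 : (-22 * X ^ 6 - 6 * (u₂ - X ^ 3) * X ^ 3 - 2 * (u₂ - X ^ 3) ^ 2) * (u₁ - X ^ 2) * (u₂ - X ^ 3) ∈ I * I :=
    Ideal.mul_mem_mul (Ideal.mul_mem_left _ _ h₁) h₂
  have hT2 : (-6 * X ^ 5 - 2 * (u₂ - X ^ 3) * X ^ 2) * (u₂ - X ^ 3) * (u₂ - X ^ 3) ∈ I * I :=
    Ideal.mul_mem_mul (Ideal.mul_mem_left _ _ h₂) h₂
  exact (I * I).add_mem ((I * I).neg_mem hu₃) ((I * I).add_mem ((I * I).add_mem hT0 hT1) hT2)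

/-- (seven_post) NON-MONIC frame `u₁ ^ 5 * X ^ 7 = G₁` (the `u₁`-chart one point blow-up after a monic stage of
multiplicity `m' = 2`): Taylor expansion over `ℤ` of `u₁ ^ 5 * X ^ 7 - (u₃ ^ 2 + 3 * u₁ ^ 4 * u₂ ^ 3 + 5 * u₁ ^ 7 * u₂)` along `u₁ = X ^ 2 + v₁`, `u₂ = X ^ 3 + v₂`, grouped by
monomials of degree `2` in `(u₃, v₁, v₂)` plus a multiple of `7`. [folklore] -/
theorem taylor_identity_seven_post (u₁ u₂ u₃ X : R) :
    u₁ ^ 5 * X ^ 7 - (u₃ ^ 2 + 3 * u₁ ^ 4 * u₂ ^ 3 + 5 * u₁ ^ 7 * u₂) =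
      -(u₃ * u₃) + ((-113 * X ^ 13 - 159 * (u₂ - X ^ 3) * X ^ 10 - 54 * (u₂ - X ^ 3) ^ 2 * X ^ 7 - 18 * (u₂ - X ^ 3) ^ 3 * X ^ 4 - 177 * (u₁ - X ^ 2) * X ^ 11 - 211 * (u₁ - X ^ 2) * (u₂ - X ^ 3) * X ^ 8 - 36 * (u₁ - X ^ 2) * (u₂ - X ^ 3) ^ 2 * X ^ 5 - 12 * (u₁ - X ^ 2) * (u₂ - X ^ 3) ^ 3 * X ^ 2 - 173 * (u₁ - X ^ 2) ^ 2 * X ^ 9 - 184 * (u₁ - X ^ 2) ^ 2 * (u₂ - X ^ 3) * X ^ 6 - 9 * (u₁ - X ^ 2) ^ 2 * (u₂ - X ^ 3) ^ 2 * X ^ 3 - 3 * (u₁ - X ^ 2) ^ 2 * (u₂ - X ^ 3) ^ 3 - 104 * (u₁ - X ^ 2) ^ 3 * X ^ 7 - 105 * (u₁ - X ^ 2) ^ 3 * (u₂ - X ^ 3) * X ^ 4 - 35 * (u₁ - X ^ 2) ^ 4 * X ^ 5 - 35 * (u₁ - X ^ 2) ^ 4 * (u₂ - X ^ 3) * X ^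 2 - 5 * (u₁ - X ^ 2) ^ 5 * X ^ 3 - 5 * (u₁ - X ^ 2) ^ 5 * (u₂ - X ^ 3)) * (u₁ - X ^ 2) * (u₁ - X ^ 2) + (-71 * X ^ 12 - 36 * (u₂ - X ^ 3) * X ^ 9 - 12 * (u₂ - X ^ 3) ^ 2 * X ^ 6) * (u₁ - X ^ 2) * (u₂ - X ^ 3) + (-9 * X ^ 11 - 3 * (u₂ - X ^ 3) * X ^ 8) * (u₂ - X ^ 3) * (u₂ - X ^ 3)) + 7 * (-1 * X ^ 17 - 2 * (u₂ - X ^ 3) * X ^ 14 - 6 * (u₁ - X ^ 2) * X ^ 15) := by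
  ring

/-- (seven_post) In characteristic `7`: `u₁ ^ 5 * X ^ 7 - (u₃ ^ 2 + 3 * u₁ ^ 4 * u₂ ^ 3 + 5 * u₁ ^ 7 * u₂) ∈ I ^ 2` for every ideal `I ∋ u₃, u₁ - X ^ 2, u₂ - X ^ 3`:
the hypersurface `u₁ ^ 5 * X ^ 7 = u₃ ^ 2 + 3 * u₁ ^ 4 * u₂ ^ 3 + 5 * u₁ ^ 7 * u₂` (reached from the monic stage `X''^7 = u₁^2·G₁(u₁,u₂/u₁,u₃/u₁)` by
blowing up the closed point, `u₁`-chart) has order `≥ 2` along the regular curve `(t ^ 2, t ^ 3, 0, t)`, whose image in the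
NEW base `Spec k[u₁,u₂,u₃]` is the singular monomial curve `(t ^ 2, t ^ 3, 0)`. [folklore] -/
theorem mem_sq_seven_post (h7 : (7 : R) = 0) (u₁ u₂ u₃ X : R) (I : Ideal R)
    (h₃ : u₃ ∈ I) (h₁ : u₁ - X ^ 2 ∈ I) (h₂ : u₂ - X ^ 3 ∈ I) :
    u₁ ^ 5 * X ^ 7 - (u₃ ^ 2 + 3 * u₁ ^ 4 * u₂ ^ 3 + 5 * u₁ ^ 7 * u₂) ∈ I ^ 2 := by
  rw [taylor_identity_seven_post, h7, zero_mul, add_zero, pow_two I]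
  have hu₃ : u₃ * u₃ ∈ I * I := Ideal.mul_mem_mul h₃ h₃
  have hT0 : (-113 * X ^ 13 - 159 * (u₂ - X ^ 3) * X ^ 10 - 54 * (u₂ - X ^ 3) ^ 2 * X ^ 7 - 18 * (u₂ - X ^ 3) ^ 3 * X ^ 4 - 177 * (u₁ - X ^ 2) * X ^ 11 - 211 * (u₁ - X ^ 2) * (u₂ - X ^ 3) * X ^ 8 - 36 * (u₁ - X ^ 2) * (u₂ - X ^ 3) ^ 2 * X ^ 5 - 12 * (u₁ - X ^ 2) * (u₂ - X ^ 3) ^ 3 * X ^ 2 - 173 * (u₁ - X ^ 2) ^ 2 * X ^ 9 - 184 * (u₁ - X ^ 2) ^ 2 * (u₂ - X ^ 3) * X ^ 6 - 9 * (u₁ - X ^ 2) ^ 2 * (u₂ - X ^ 3) ^ 2 * X ^ 3 - 3 * (u₁ - X ^ 2) ^ 2 * (u₂ - X ^ 3) ^ 3 - 104 * (u₁ - X ^ 2) ^ 3 * X ^ 7 - 105 * (u₁ - X ^ 2) ^ 3 * (u₂ - X ^ 3) * X ^ 4 - 35 * (u₁ - X ^ 2) ^ 4 * X ^ 5 - 35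 * (u₁ - X ^ 2) ^ 4 * (u₂ - X ^ 3) * X ^ 2 - 5 * (u₁ - X ^ 2) ^ 5 * X ^ 3 - 5 * (u₁ - X ^ 2) ^ 5 * (u₂ - X ^ 3)) * (u₁ - X ^ 2) * (u₁ - X ^ 2) ∈ I * I :=
    Ideal.mul_mem_mul (Ideal.mul_mem_left _ _ h₁) h₁
  have hT1 : (-71 * X ^ 12 - 36 * (u₂ - X ^ 3) * X ^ 9 - 12 * (u₂ - X ^ 3) ^ 2 * X ^ 6) * (u₁ - X ^ 2) * (u₂ - X ^ 3) ∈ I * I :=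
    Ideal.mul_mem_mul (Ideal.mul_mem_left _ _ h₁) h₂
  have hT2 : (-9 * X ^ 11 - 3 * (u₂ - X ^ 3) * X ^ 8) * (u₂ - X ^ 3) * (u₂ - X ^ 3) ∈ I * I :=
    Ideal.mul_mem_mul (Ideal.mul_mem_left _ _ h₂) h₂
  exact (I * I).add_mem ((I * I).neg_mem hu₃) ((I * I).add_mem ((I * I).add_mem hT0 hT1) hT2)


end PostBlowup

section ThreePost

variable {R : Type*} [CommRing R]

/-- (`p = 3`, one PERMISSIBLE move after the entry stage) Taylor expansion over `ℤ` of `h₁ = u₁·X³ − (u₂² + 2u₁² + 2u₃³)` along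
`u₁ = X³ + v₁`, `u₃ = X² + v₃`, grouped by monomials of degree `2` in `(u₂, v₁, v₃)` plus a multiple of `3`.  Here
`h₁ = u₁X³ − G₁` is the strict transform, in the `u₁`-chart of the blowing up of the permissible curve `V(u₁, u₂, X'')`
(regular base image `V(u₁,u₂)`), of the MONIC entry stage `X''³ = u₂² + 2u₁⁴ + 2u₁²u₃³` (multiplicity `2 < 3`); the origin of
that chart is the centre of the monomial valuation `μ(u₁,u₂,u₃) = (1,2,1)`. [folklore] -/
theorem taylor_identity_three_post (u₁ u₂ u₃ X : R) :
    u₁ * X ^ 3 - (u₂ ^ 2 + 2 * u₁ ^ 2 + 2 * u₃ ^ 3) =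
      -(u₂ * u₂)
        - (2 * (u₁ - X ^ 3) * (u₁ - X ^ 3) + (2 * (u₃ - X ^ 2) + 6 * X ^ 2) * (u₃ - X ^ 2) * (u₃ - X ^ 2))
        - 3 * (X ^ 6 + X ^ 3 * (u₁ - X ^ 3) + 2 * X ^ 4 * (u₃ - X ^ 2)) := by
  ring

/-- (`p = 3`) In characteristic `3`: `u₁X³ − (u₂² + 2u₁² + 2u₃³) ∈ I²` for every ideal `I ∋ u₂, u₁ − X³, u₃ − X²` — the
second-stage hypersurface `u₁X³ = u₂² + 2u₁² + 2u₃³` has order `≥ 2` (hence `= 2`, the `u₂²` term) along the REGULAR curve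
`Y₁ = {(t³, 0, t², t)}`, whose image in the base `Spec k[u₁,u₂,u₃]` is the CUSP `{u₂ = 0, u₁² = u₃³}`: a Hironaka-permissible
centre with singular base image at `p = 3`, one permissible (Q-Krat-shaped) move after a monic entry stage. [folklore] -/
theorem mem_sq_three_post (h3 : (3 : R) = 0) (u₁ u₂ u₃ X : R) (I : Ideal R)
    (h₂ : u₂ ∈ I) (h₁ : u₁ - X ^ 3 ∈ I) (h₃ : u₃ - X ^ 2 ∈ I) :
    u₁ * X ^ 3 - (u₂ ^ 2 + 2 * u₁ ^ 2 + 2 * u₃ ^ 3) ∈ I ^ 2 := by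
  rw [taylor_identity_three_post, h3, zero_mul, sub_zero, pow_two I]
  have hu₂ : u₂ * u₂ ∈ I * I := Ideal.mul_mem_mul h₂ h₂
  have hA : 2 * (u₁ - X ^ 3) * (u₁ - X ^ 3) ∈ I * I := Ideal.mul_mem_mul (Ideal.mul_mem_left _ _ h₁) h₁
  have hB : (2 * (u₃ - X ^ 2) + 6 * X ^ 2) * (u₃ - X ^ 2) * (u₃ - X ^ 2) ∈ I * I :=
    Ideal.mul_mem_mul (Ideal.mul_mem_left _ _ h₃) h₃
  exact (I * I).sub_mem ((I * I).neg_mem hu₂) ((I * I).add_mem hA hB)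

/-- (`p = 3`) Every point `(t³, 0, t², t)` of `Y₁` is a common zero of `h₁`, `∂h₁/∂u₁ = X³ − 4u₁`, `∂h₁/∂u₂ = −2u₂`,
`∂h₁/∂u₃ = −6u₃²` (and `∂h₁/∂X = 3u₁X² ≡ 0`): `Y₁ ⊆ Sing(𝒳₁)` by the Jacobian criterion. [folklore] -/
theorem curve_in_sing_three_post (h3 : (3 : R) = 0) (t : R) :
    (t ^ 3 * t ^ 3 - ((0 : R) ^ 2 + 2 * (t ^ 3) ^ 2 + 2 * (t ^ 2) ^ 3) = 0)
    ∧ (t ^ 3 - 4 * t ^ 3 = 0) ∧ (-(2 * (0 : R)) = 0) ∧ (-(6 * (t ^ 2) ^ 2) = 0) := by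
  refine ⟨?_, ?_, by simp, ?_⟩
  · linear_combination (-(t ^ 6)) * h3
  · linear_combination (-(t ^ 3)) * h3
  · linear_combination (-2 * t ^ 4) * h3

/-- (`p = 3`) Over any FIELD of characteristic `3`: conversely every common zero of `h₁, ∂h₁/∂u₁, ∂h₁/∂u₂` lies on
`Y₁ = {(t³, 0, t², t)}`.  With `curve_in_sing_three_post` and `mem_sq_three_post`: `Sing(𝒳₁) = Sing₂(𝒳₁) = Y₁` as sets, a regular
curve over the cusp `u₁² = u₃³`; `Sing₃(𝒳₁) = ∅` (the quadratic part contains `−U₂²`), so `Y₁` is the whole top multiplicity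
stratum of the second stage and the CANONICAL Hironaka centre there — at `p = 3`. [folklore] -/
theorem sing_on_curve_three_post {K : Type*} [Field K] (h3 : (3 : K) = 0) (u₁ u₂ u₃ X : K)
    (hh : u₁ * X ^ 3 - (u₂ ^ 2 + 2 * u₁ ^ 2 + 2 * u₃ ^ 3) = 0)
    (hd₁ : X ^ 3 - 4 * u₁ = 0) (hd₂ : -(2 * u₂) = 0) :
    ∃ t : K, u₁ = t ^ 3 ∧ u₂ = 0 ∧ u₃ = t ^ 2 ∧ X = t := by
  have hu₁ : u₁ = X ^ 3 := by linear_combination (-1 : K) * hd₁ - u₁ * h3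
  have hu₂ : u₂ = 0 := by linear_combination hd₂ + u₂ * h3
  subst hu₁ hu₂
  have hX : (u₃ - X ^ 2) ^ 3 = 0 := by
    linear_combination hh + (u₃ ^ 3 - u₃ ^ 2 * X ^ 2 + u₃ * X ^ 4) * h3
  exact ⟨X, rfl, rfl, sub_eq_zero.mp ((pow_eq_zero_iff (by norm_num)).mp hX), rfl⟩

end ThreePost

section CanonicalFiveSeven

variable {R : Type*} [CommRing R]

/-- (`p = 5`, CANONICAL second-stage example) Taylor expansion over `ℤ` of `h₁ = u₁·X⁵ − (u₃² + 3u₁²u₂ + 3u₂⁴)` along `u₁ = X³ + v₁`,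
`u₂ = X² + v₂`.  `h₁ = u₁X⁵ − G₁` is the strict transform, in the `u₁`-chart of the blowing up of the closed point, of the monic stage
`X''⁵ = u₁²u₃² + 3u₁⁵u₂ + 3u₂⁴` (multiplicity `4 < 5`); the chart origin is the centre of `μ(u₁,u₂,u₃) = (1,2,2)`. [folklore] -/
theorem taylor_identity_five_canon (u₁ u₂ u₃ X : R) :
    u₁ * X ^ 5 - (u₃ ^ 2 + 3 * u₁ ^ 2 * u₂ + 3 * u₂ ^ 4) =
      -(u₃ * u₃)
        - ((3 * X ^ 2 + 3 * (u₂ - X ^ 2)) * (u₁ - X ^ 3) * (u₁ - X ^ 3) + 6 * X ^ 3 * (u₁ - X ^ 3) * (u₂ - X ^ 2)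
            + (18 * X ^ 4 + 12 * X ^ 2 * (u₂ - X ^ 2) + 3 * (u₂ - X ^ 2) ^ 2) * (u₂ - X ^ 2) * (u₂ - X ^ 2))
        - 5 * (X ^ 8 + X ^ 5 * (u₁ - X ^ 3) + 3 * X ^ 6 * (u₂ - X ^ 2)) := by
  ring

/-- (`p = 5`) In characteristic `5`: `u₁X⁵ − (u₃² + 3u₁²u₂ + 3u₂⁴) ∈ I²` for every ideal `I ∋ u₃, u₁ − X³, u₂ − X²`: order `2` along the regular
curve `Y₁ = {(t³, t², 0, t)}`, whose base image is the cusp `u₁² = u₂³` (exceptional parameter `u₁ = t³`). [folklore] -/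
theorem mem_sq_five_canon (h5 : (5 : R) = 0) (u₁ u₂ u₃ X : R) (I : Ideal R)
    (h₃ : u₃ ∈ I) (h₁ : u₁ - X ^ 3 ∈ I) (h₂ : u₂ - X ^ 2 ∈ I) :
    u₁ * X ^ 5 - (u₃ ^ 2 + 3 * u₁ ^ 2 * u₂ + 3 * u₂ ^ 4) ∈ I ^ 2 := by
  rw [taylor_identity_five_canon, h5, zero_mul, sub_zero, pow_two I]
  have hu₃ : u₃ * u₃ ∈ I * I := Ideal.mul_mem_mul h₃ h₃
  have hA : (3 * X ^ 2 + 3 * (u₂ - X ^ 2)) * (u₁ - X ^ 3) * (u₁ - X ^ 3) ∈ I * I :=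
    Ideal.mul_mem_mul (Ideal.mul_mem_left _ _ h₁) h₁
  have hB : 6 * X ^ 3 * (u₁ - X ^ 3) * (u₂ - X ^ 2) ∈ I * I := Ideal.mul_mem_mul (Ideal.mul_mem_left _ _ h₁) h₂
  have hC : (18 * X ^ 4 + 12 * X ^ 2 * (u₂ - X ^ 2) + 3 * (u₂ - X ^ 2) ^ 2) * (u₂ - X ^ 2) * (u₂ - X ^ 2) ∈ I * I :=
    Ideal.mul_mem_mul (Ideal.mul_mem_left _ _ h₂) h₂
  exact (I * I).sub_mem ((I * I).neg_mem hu₃) ((I * I).add_mem ((I * I).add_mem hA hB) hC)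

/-- (`p = 5`) Every point `(t³, t², 0, t)` is a common zero of `h₁`, `∂h₁/∂u₁ = X⁵ − 6u₁u₂`, `−∂h₁/∂u₂ = 3u₁² + 12u₂³`, `∂h₁/∂u₃ = −2u₃`.
[folklore] -/
theorem curve_in_sing_five_canon (h5 : (5 : R) = 0) (t : R) :
    (t ^ 3 * t ^ 5 - ((0 : R) ^ 2 + 3 * (t ^ 3) ^ 2 * t ^ 2 + 3 * (t ^ 2) ^ 4) = 0)
    ∧ (t ^ 5 - 6 * t ^ 3 * t ^ 2 = 0) ∧ (3 * (t ^ 3) ^ 2 + 12 * (t ^ 2) ^ 3 = 0) ∧ (-(2 * (0 : R)) = 0) := by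
  refine ⟨?_, ?_, ?_, by simp⟩
  · linear_combination (-(t ^ 8)) * h5
  · linear_combination (-(t ^ 5)) * h5
  · linear_combination (3 * t ^ 6) * h5

/-- (`p = 5`) Over any FIELD of characteristic `5`, every common zero of the three derivatives `∂h₁/∂u₁, ∂h₁/∂u₂, ∂h₁/∂u₃` already lies on
`Y₁ = {(t³, t², 0, t)}`; with `curve_in_sing_five_canon` and `mem_sq_five_canon`: `Sing(𝒳₁) = Sing₂(𝒳₁) = Y₁` (the fibre line is not singular:
`M = u₁` has degree one), `Sing₃ = ∅` — `Y₁` is the CANONICAL centre of this second stage, over the cusp, at `p = 5`. [folklore] -/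
theorem sing_on_curve_five_canon {K : Type*} [Field K] (h5 : (5 : K) = 0) (u₁ u₂ u₃ X : K)
    (hd₁ : X ^ 5 - 6 * u₁ * u₂ = 0) (hd₂ : 3 * u₁ ^ 2 + 12 * u₂ ^ 3 = 0) (hd₃ : -(2 * u₃) = 0) :
    ∃ t : K, u₁ = t ^ 3 ∧ u₂ = t ^ 2 ∧ u₃ = 0 ∧ X = t := by
  have hu₃ : u₃ = 0 := by linear_combination 2 * hd₃ + u₃ * h5
  have hcusp : u₁ ^ 2 = u₂ ^ 3 := by linear_combination 2 * hd₂ + (-(u₁ ^ 2) - 5 * u₂ ^ 3) * h5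
  obtain ⟨t, ht₂, ht₁⟩ := cusp_param u₂ u₁ hcusp
  refine ⟨t, ht₁, ht₂, hu₃, ?_⟩
  subst ht₁ ht₂
  have hX : (X - t) ^ 5 = 0 := by
    linear_combination hd₁ + (t ^ 5 - X ^ 4 * t + 2 * X ^ 3 * t ^ 2 - 2 * X ^ 2 * t ^ 3 + X * t ^ 4) * h5
  exact sub_eq_zero.mp ((pow_eq_zero_iff (by norm_num)).mp hX)

/-- (`p = 7`, CANONICAL second-stage example) Taylor expansion over `ℤ` of `h₁ = u₁·X⁷ − (u₃² + 5u₁³u₂ + 3u₂³)` along `u₁ = X² + v₁`,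
`u₂ = X³ + v₂`.  `h₁ = u₁X⁷ − G₁` is the strict transform, in the `u₁`-chart of the blowing up of the closed point, of the monic stage
`X''⁷ = u₁⁴u₃² + 5u₁⁸u₂ + 3u₁³u₂³` (multiplicity `6 < 7`); the chart origin is the centre of `μ(u₁,u₂,u₃) = (1,2,2)`. [folklore] -/
theorem taylor_identity_seven_canon (u₁ u₂ u₃ X : R) :
    u₁ * X ^ 7 - (u₃ ^ 2 + 5 * u₁ ^ 3 * u₂ + 3 * u₂ ^ 3) =
      -(u₃ * u₃)
        - ((15 * X ^ 5 + 15 * X ^ 2 * (u₂ - X ^ 3) + 5 * X ^ 3 * (u₁ - X ^ 2) + 5 * (u₁ - X ^ 2) * (u₂ - X ^ 3))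
              * (u₁ - X ^ 2) * (u₁ - X ^ 2)
            + 15 * X ^ 4 * (u₁ - X ^ 2) * (u₂ - X ^ 3)
            + (9 * X ^ 3 + 3 * (u₂ - X ^ 3)) * (u₂ - X ^ 3) * (u₂ - X ^ 3))
        - 7 * (X ^ 9 + 2 * X ^ 7 * (u₁ - X ^ 2) + 2 * X ^ 6 * (u₂ - X ^ 3)) := by
  ring

/-- (`p = 7`) In characteristic `7`: `u₁X⁷ − (u₃² + 5u₁³u₂ + 3u₂³) ∈ I²` for every ideal `I ∋ u₃, u₁ − X², u₂ − X³`: order `2` along the regular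
curve `Y₁ = {(t², t³, 0, t)}` over the cusp `u₂² = u₁³`. [folklore] -/
theorem mem_sq_seven_canon (h7 : (7 : R) = 0) (u₁ u₂ u₃ X : R) (I : Ideal R)
    (h₃ : u₃ ∈ I) (h₁ : u₁ - X ^ 2 ∈ I) (h₂ : u₂ - X ^ 3 ∈ I) :
    u₁ * X ^ 7 - (u₃ ^ 2 + 5 * u₁ ^ 3 * u₂ + 3 * u₂ ^ 3) ∈ I ^ 2 := by
  rw [taylor_identity_seven_canon, h7, zero_mul, sub_zero, pow_two I]
  have hu₃ : u₃ * u₃ ∈ I * I := Ideal.mul_mem_mul h₃ h₃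
  have hA : (15 * X ^ 5 + 15 * X ^ 2 * (u₂ - X ^ 3) + 5 * X ^ 3 * (u₁ - X ^ 2) + 5 * (u₁ - X ^ 2) * (u₂ - X ^ 3))
      * (u₁ - X ^ 2) * (u₁ - X ^ 2) ∈ I * I :=
    Ideal.mul_mem_mul (Ideal.mul_mem_left _ _ h₁) h₁
  have hB : 15 * X ^ 4 * (u₁ - X ^ 2) * (u₂ - X ^ 3) ∈ I * I := Ideal.mul_mem_mul (Ideal.mul_mem_left _ _ h₁) h₂
  have hC : (9 * X ^ 3 + 3 * (u₂ - X ^ 3)) * (u₂ - X ^ 3) * (u₂ - X ^ 3) ∈ I * I :=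
    Ideal.mul_mem_mul (Ideal.mul_mem_left _ _ h₂) h₂
  exact (I * I).sub_mem ((I * I).neg_mem hu₃) ((I * I).add_mem ((I * I).add_mem hA hB) hC)

/-- (`p = 7`) Every point `(t², t³, 0, t)` is a common zero of `h₁`, `∂h₁/∂u₁ = X⁷ − 15u₁²u₂`, `−∂h₁/∂u₂ = 5u₁³ + 9u₂²`, `∂h₁/∂u₃ = −2u₃`.
[folklore] -/
theorem curve_in_sing_seven_canon (h7 : (7 : R) = 0) (t : R) :
    (t ^ 2 * t ^ 7 - ((0 : R) ^ 2 + 5 * (t ^ 2) ^ 3 * t ^ 3 + 3 * (t ^ 3) ^ 3) = 0)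
    ∧ (t ^ 7 - 15 * (t ^ 2) ^ 2 * t ^ 3 = 0) ∧ (5 * (t ^ 2) ^ 3 + 9 * (t ^ 3) ^ 2 = 0) ∧ (-(2 * (0 : R)) = 0) := by
  refine ⟨?_, ?_, ?_, by simp⟩
  · linear_combination (-(t ^ 9)) * h7
  · linear_combination (-2 * t ^ 7) * h7
  · linear_combination (2 * t ^ 6) * h7

/-- (`p = 7`) Over any FIELD of characteristic `7`, every common zero of `∂h₁/∂u₁, ∂h₁/∂u₂, ∂h₁/∂u₃` lies on `Y₁ = {(t², t³, 0, t)}`; hence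
`Sing(𝒳₁) = Sing₂(𝒳₁) = Y₁`, `Sing₃ = ∅` — `Y₁` is the CANONICAL centre of this second stage, over the cusp, at `p = 7`. [folklore] -/
theorem sing_on_curve_seven_canon {K : Type*} [Field K] (h7 : (7 : K) = 0) (u₁ u₂ u₃ X : K)
    (hd₁ : X ^ 7 - 15 * u₁ ^ 2 * u₂ = 0) (hd₂ : 5 * u₁ ^ 3 + 9 * u₂ ^ 2 = 0) (hd₃ : -(2 * u₃) = 0) :
    ∃ t : K, u₁ = t ^ 2 ∧ u₂ = t ^ 3 ∧ u₃ = 0 ∧ X = t := by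
  have hu₃ : u₃ = 0 := by linear_combination 3 * hd₃ + u₃ * h7
  have hcusp : u₂ ^ 2 = u₁ ^ 3 := by linear_combination 4 * hd₂ + (-3 * u₁ ^ 3 - 5 * u₂ ^ 2) * h7
  obtain ⟨t, ht₁, ht₂⟩ := cusp_param u₁ u₂ hcusp
  refine ⟨t, ht₁, ht₂, hu₃, ?_⟩
  subst ht₁ ht₂
  have hX : (X - t) ^ 7 = 0 := by
    linear_combination hd₁
      + (-(X ^ 6) * t + 3 * X ^ 5 * t ^ 2 - 5 * X ^ 4 * t ^ 3 + 5 * X ^ 3 * t ^ 4 - 3 * X ^ 2 * t ^ 5 + X * t ^ 6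
          + 2 * t ^ 7) * h7
  exact sub_eq_zero.mp ((pow_eq_zero_iff (by norm_num)).mp hX)

end CanonicalFiveSeven

section Boundary

/-! ### With boundary (memo §5ter): B-permissible centres inside the exceptional divisor

The curves of Theorem 2 are tangent to the exceptional divisor `E₁ = V(u₁)`, hence not B-permissible. Inside `E₁` one finds
(memo Theorem 3) B-permissible curves with SINGULAR base image for `p = 5` (after a Q-Krat curve move of multiplicity `4`) and
`p = 7` (after a point move of multiplicity `6`), and (memo Theorem 4) for `p = 3` a B-permissible curve with REGULAR base image
over which it is purely inseparable of degree `3` — the whole singular locus of its stage, so the canonical centre, and not of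
Q-Krat shape in any adapted frame.  The membership certificates below are characteristic-free. -/

variable {R : Type*} [CommRing R]

/-- (`p = 5`, inside `E₁`) `u₁X⁵ − (u₁² + u₁u₂u₃ + (u₃³ − u₂²)²) ∈ I²` for every ideal `I ∋ u₁, u₂ − X³, u₃ − X²`: the stage
`h₁ = u₁W⁵ − G₁` (strict transform, `u₁`-chart, of the monic multiplicity-`4` stage `W''⁵ = u₁⁶ + u₁⁴u₂u₃ + (u₁²u₃³ − u₂²)²` under the
blowing up of the permissible curve `V(u₁,u₂,W'')`) has order `2` along the regular curve `Y = {(0, t³, t², t)} ⊂ E₁ = V(u₁)`, whose base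
image is the cusp `u₂² = u₃³` of the exceptional plane. [folklore] -/
theorem mem_sq_five_inE (u₁ u₂ u₃ X : R) (I : Ideal R)
    (h₁ : u₁ ∈ I) (h₂ : u₂ - X ^ 3 ∈ I) (h₃ : u₃ - X ^ 2 ∈ I) :
    u₁ * X ^ 5 - (u₁ ^ 2 + u₁ * u₂ * u₃ + (u₃ ^ 3 - u₂ ^ 2) ^ 2) ∈ I ^ 2 := by
  have hA : X ^ 5 - u₂ * u₃ ∈ I := by
    have e : X ^ 5 - u₂ * u₃ = -((u₂ - X ^ 3) * u₃ + X ^ 3 * (u₃ - X ^ 2)) := by ring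
    rw [e]; exact I.neg_mem (I.add_mem (I.mul_mem_right _ h₂) (I.mul_mem_left _ h₃))
  have hf : u₃ ^ 3 - u₂ ^ 2 ∈ I := by
    have e : u₃ ^ 3 - u₂ ^ 2 = (u₃ - X ^ 2) * (u₃ ^ 2 + u₃ * X ^ 2 + X ^ 4) - (u₂ - X ^ 3) * (u₂ + X ^ 3) := by ring
    rw [e]; exact I.sub_mem (I.mul_mem_right _ h₃) (I.mul_mem_right _ h₂)
  have e : u₁ * X ^ 5 - (u₁ ^ 2 + u₁ * u₂ * u₃ + (u₃ ^ 3 - u₂ ^ 2) ^ 2)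
      = u₁ * (X ^ 5 - u₂ * u₃) - u₁ * u₁ - (u₃ ^ 3 - u₂ ^ 2) * (u₃ ^ 3 - u₂ ^ 2) := by ring
  rw [pow_two I, e]
  exact (I * I).sub_mem ((I * I).sub_mem (Ideal.mul_mem_mul h₁ hA) (Ideal.mul_mem_mul h₁ h₁)) (Ideal.mul_mem_mul hf hf)

/-- (`p = 7`, inside `E₁`) `u₁X⁷ − (u₁² + u₁u₂²u₃ + (u₂³ − u₃²)²) ∈ I²` for every ideal `I ∋ u₁, u₂ − X², u₃ − X³`: the stage
`h₁ = u₁W⁷ − G₁` (strict transform, `u₁`-chart, of the monic multiplicity-`6` stage `W''⁷ = u₁⁸ + u₁⁴u₂²u₃ + (u₂³ − u₁u₃²)²` under the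
blowing up of the closed point) has order `2` along the regular curve `Y = {(0, t², t³, t)} ⊂ E₁`, over the cusp of the exceptional
plane. [folklore] -/
theorem mem_sq_seven_inE (u₁ u₂ u₃ X : R) (I : Ideal R)
    (h₁ : u₁ ∈ I) (h₂ : u₂ - X ^ 2 ∈ I) (h₃ : u₃ - X ^ 3 ∈ I) :
    u₁ * X ^ 7 - (u₁ ^ 2 + u₁ * u₂ ^ 2 * u₃ + (u₂ ^ 3 - u₃ ^ 2) ^ 2) ∈ I ^ 2 := by
  have hA : X ^ 7 - u₂ ^ 2 * u₃ ∈ I := by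
    have e : X ^ 7 - u₂ ^ 2 * u₃ = -((u₂ - X ^ 2) * ((u₂ + X ^ 2) * u₃) + X ^ 4 * (u₃ - X ^ 3)) := by ring
    rw [e]; exact I.neg_mem (I.add_mem (I.mul_mem_right _ h₂) (I.mul_mem_left _ h₃))
  have hf : u₂ ^ 3 - u₃ ^ 2 ∈ I := by
    have e : u₂ ^ 3 - u₃ ^ 2 = (u₂ - X ^ 2) * (u₂ ^ 2 + u₂ * X ^ 2 + X ^ 4) - (u₃ - X ^ 3) * (u₃ + X ^ 3) := by ring
    rw [e]; exact I.sub_mem (I.mul_mem_right _ h₂) (I.mul_mem_right _ h₃)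
  have e : u₁ * X ^ 7 - (u₁ ^ 2 + u₁ * u₂ ^ 2 * u₃ + (u₂ ^ 3 - u₃ ^ 2) ^ 2)
      = u₁ * (X ^ 7 - u₂ ^ 2 * u₃) - u₁ * u₁ - (u₂ ^ 3 - u₃ ^ 2) * (u₂ ^ 3 - u₃ ^ 2) := by ring
  rw [pow_two I, e]
  exact (I * I).sub_mem ((I * I).sub_mem (Ideal.mul_mem_mul h₁ hA) (Ideal.mul_mem_mul h₁ h₁)) (Ideal.mul_mem_mul hf hf)

/-- (`p = 3`, entry stage of memo Theorem 4) `X³ − (u₂² + u₁³u₃) ∈ I²` for every ideal `I ∋ u₁, u₂, X`: the monic multiplicity-`2` stage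
`W³ = u₂² + u₁³u₃` has order `2` along the Q-Krat curve `Y₀ = V(u₁,u₂,W)` (regular base image `V(u₁,u₂)`). [folklore] -/
theorem mem_sq_three_ms_entry (u₁ u₂ u₃ X : R) (I : Ideal R) (h₁ : u₁ ∈ I) (h₂ : u₂ ∈ I) (hX : X ∈ I) :
    X ^ 3 - (u₂ ^ 2 + u₁ ^ 3 * u₃) ∈ I ^ 2 := by
  have e : X ^ 3 - (u₂ ^ 2 + u₁ ^ 3 * u₃) = X * X * X - u₂ * u₂ - u₁ * (u₁ * (u₁ * u₃)) := by ring
  rw [pow_two I, e]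
  refine (I * I).sub_mem ((I * I).sub_mem ?_ (Ideal.mul_mem_mul h₂ h₂)) (Ideal.mul_mem_mul h₁ (I.mul_mem_right _ h₁))
  exact (I * I).mul_mem_right X (Ideal.mul_mem_mul hX hX)

/-- (`p = 3`, entry stage) Over a field of characteristic `3`, the common zeros of `h = X³ − u₂² − u₁³u₃`, `∂h/∂u₂ = −2u₂`, `∂h/∂u₃ = −u₁³`
(`∂h/∂u₁ = −3u₁²u₃ ≡ 0 ≡ ∂h/∂X`) are exactly the points of `Y₀ = V(u₁,u₂,X)`: `Sing = Sing₂ = Y₀`, the canonical centre. [folklore] -/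
theorem sing_three_ms_entry {K : Type*} [Field K] (h3 : (3 : K) = 0) (u₁ u₂ u₃ X : K)
    (hh : X ^ 3 - (u₂ ^ 2 + u₁ ^ 3 * u₃) = 0) (hd₂ : -(2 * u₂) = 0) (hd₃ : -(u₁ ^ 3) = 0) :
    u₁ = 0 ∧ u₂ = 0 ∧ X = 0 := by
  have hu₁ : u₁ = 0 := (pow_eq_zero_iff (by norm_num)).mp (neg_eq_zero.mp hd₃)
  have hu₂ : u₂ = 0 := by linear_combination hd₂ + u₂ * h3
  refine ⟨hu₁, hu₂, ?_⟩
  subst hu₁ hu₂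
  have hX : X ^ 3 = 0 := by linear_combination hh
  exact (pow_eq_zero_iff (by norm_num)).mp hX

/-- (`p = 3`, second stage of memo Theorem 4) `u₁X³ − (u₂² + u₁u₃) ∈ I²` for every ideal `I ∋ u₁, u₂, X³ − u₃` (any ring): the strict
transform `h₁ = u₁W³ − u₂'² − u₁u₃` (`u₁`-chart of the blowing up of `Y₀`) has order `2` along `Y₁ = V(u₁, u₂', W³ − u₃)`, a regular curve
INSIDE `E₁ = V(u₁)` (so B-permissible) whose base image is the regular `u₃`-axis, over which `Y₁` is purely inseparable of degree `3`
(`u₃ = W³`): not a section, not of Q-Krat shape `V(u_J, W − c(u))` in any adapted frame. [folklore] -/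
theorem mem_sq_three_ms (u₁ u₂ u₃ X : R) (I : Ideal R) (h₁ : u₁ ∈ I) (h₂ : u₂ ∈ I) (h₃ : X ^ 3 - u₃ ∈ I) :
    u₁ * X ^ 3 - (u₂ ^ 2 + u₁ * u₃) ∈ I ^ 2 := by
  have e : u₁ * X ^ 3 - (u₂ ^ 2 + u₁ * u₃) = u₁ * (X ^ 3 - u₃) - u₂ * u₂ := by ring
  rw [pow_two I, e]
  exact (I * I).sub_mem (Ideal.mul_mem_mul h₁ h₃) (Ideal.mul_mem_mul h₂ h₂)

/-- (`p = 3`, second stage) In characteristic `3` the common zeros of `∂h₁/∂u₁ = X³ − u₃`, `∂h₁/∂u₂' = −2u₂'`, `∂h₁/∂u₃ = −u₁`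
(`∂h₁/∂X = 3u₁X² ≡ 0`; `h₁` then vanishes) are exactly the points of `Y₁ = V(u₁, u₂', X³ − u₃)`: `Sing(𝒳₁) = Sing₂(𝒳₁) = Y₁` — the
canonical centre is this inseparable multisection (`𝒳₁ ≅ {u₁v = u₂'²} × 𝔸¹`, `v = W³ − u₃`). [folklore] -/
theorem sing_three_ms (h3 : (3 : R) = 0) (u₁ u₂ u₃ X : R)
    (hd₁ : X ^ 3 - u₃ = 0) (hd₂ : -(2 * u₂) = 0) (hd₃ : -u₁ = 0) :
    u₁ = 0 ∧ u₂ = 0 ∧ u₃ = X ^ 3 := by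
  refine ⟨neg_eq_zero.mp hd₃, ?_, ?_⟩
  · linear_combination hd₂ + u₂ * h3
  · linear_combination (-1 : R) * hd₁

/-- (`p = 5`, inside `E₁`, converse of `mem_sq_five_inE` near the chart origin) Over a field of characteristic `5`,
every common zero of `h₁ = u₁X⁵ − (u₁² + u₁u₂u₃ + (u₃³ − u₂²)²)` and of `∂h₁/∂u₁ = X⁵ − 2u₁ − u₂u₃`,
`∂h₁/∂u₂ = −u₁u₃ + 4u₂(u₃³ − u₂²)`, `∂h₁/∂u₃ = −u₁u₂ − 6u₃²(u₃³ − u₂²)` (`∂h₁/∂X = 5u₁X⁴ ≡ 0`) with `u₃ ≠ 1` lies on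
the curve `Y = {(0, t³, t², t)}`: by the Jacobian criterion, `Sing(𝒳₁) = Y` near `x₁` — the B-permissible curve with
cuspidal base image is the whole singular locus of this stage. [folklore] -/
theorem sing_on_curve_five_inE {K : Type*} [Field K] (h5 : (5 : K) = 0) (u₁ u₂ u₃ X : K) (hne : u₃ ≠ 1)
    (hh : u₁ * X ^ 5 - (u₁ ^ 2 + u₁ * u₂ * u₃ + (u₃ ^ 3 - u₂ ^ 2) ^ 2) = 0)
    (hd₁ : X ^ 5 - (2 * u₁ + u₂ * u₃) = 0)
    (hd₂ : -(u₁ * u₃) + 4 * u₂ * (u₃ ^ 3 - u₂ ^ 2) = 0)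
    (hd₃ : -(u₁ * u₂) - 6 * u₃ ^ 2 * (u₃ ^ 3 - u₂ ^ 2) = 0) :
    ∃ t : K, u₁ = 0 ∧ u₂ = t ^ 3 ∧ u₃ = t ^ 2 ∧ X = t := by
  have h1u₃ : 1 - u₃ ≠ 0 := sub_ne_zero.mpr (Ne.symm hne)
  have hsq : (u₃ ^ 3 - u₂ ^ 2 - u₁) * (u₃ ^ 3 - u₂ ^ 2 + u₁) = 0 := by
    linear_combination (-1 : K) * hh + u₁ * hd₁
  have hu₁ : u₁ = 0 := by
    by_contra hne₁
    rcases mul_eq_zero.mp hsq with hA | hB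
    · have e1 : u₁ * (4 * u₂ - u₃) = 0 := by linear_combination hd₂ - 4 * u₂ * hA
      have e2 : u₁ * (u₂ + u₃ ^ 2) = 0 := by
        linear_combination (-1 : K) * hd₃ - u₃ ^ 2 * hA - u₃ ^ 2 * (u₃ ^ 3 - u₂ ^ 2) * h5
      have f1 : 4 * u₂ - u₃ = 0 := (mul_eq_zero.mp e1).resolve_left hne₁
      have f2 : u₂ + u₃ ^ 2 = 0 := (mul_eq_zero.mp e2).resolve_left hne₁
      have e3 : u₃ * (1 - u₃) = 0 := by linear_combination (-1 : K) * f1 + 4 * f2 - u₃ ^ 2 * h5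
      have hu₃ : u₃ = 0 := (mul_eq_zero.mp e3).resolve_right h1u₃
      have hu₂ : u₂ = 0 := by linear_combination f2 - u₃ * hu₃
      exact hne₁ (by linear_combination (-1 : K) * hA + (u₃ ^ 2) * hu₃ - u₂ * hu₂)
    · have e1 : u₁ * (u₃ + 4 * u₂) = 0 := by linear_combination (-1 : K) * hd₂ + 4 * u₂ * hB
      have e2 : u₁ * (u₃ ^ 2 - u₂) = 0 := by
        linear_combination hd₃ + 6 * u₃ ^ 2 * hB - u₁ * u₃ ^ 2 * h5
      have f1 : u₃ + 4 * u₂ = 0 := (mul_eq_zero.mp e1).resolve_left hne₁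
      have f2 : u₃ ^ 2 - u₂ = 0 := (mul_eq_zero.mp e2).resolve_left hne₁
      have e3 : u₃ * (1 - u₃) = 0 := by linear_combination f1 + 4 * f2 - u₃ ^ 2 * h5
      have hu₃ : u₃ = 0 := (mul_eq_zero.mp e3).resolve_right h1u₃
      have hu₂ : u₂ = 0 := by linear_combination (-1 : K) * f2 + u₃ * hu₃
      exact hne₁ (by linear_combination hB - (u₃ ^ 2) * hu₃ + u₂ * hu₂)
  subst hu₁
  have hD2 : (u₃ ^ 3 - u₂ ^ 2) ^ 2 = 0 := by linear_combination (-1 : K) * hh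
  have hcusp : u₂ ^ 2 = u₃ ^ 3 := by
    linear_combination (-1 : K) * ((pow_eq_zero_iff (two_ne_zero)).mp hD2)
  obtain ⟨t, ht₃, ht₂⟩ := cusp_param u₃ u₂ hcusp
  refine ⟨t, rfl, ht₂, ht₃, ?_⟩
  subst ht₃ ht₂
  have hX : (X - t) ^ 5 = 0 := by
    linear_combination hd₁ + (-(X ^ 4 * t) + 2 * X ^ 3 * t ^ 2 - 2 * X ^ 2 * t ^ 3 + X * t ^ 4) * h5
  exact sub_eq_zero.mp ((pow_eq_zero_iff (by norm_num)).mp hX)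

/-- (`p = 7`, inside `E₁`, converse of `mem_sq_seven_inE` near the chart origin) Over a field of characteristic `7`,
every common zero of `h₁ = u₁X⁷ − (u₁² + u₁u₂²u₃ + (u₂³ − u₃²)²)` and of `∂h₁/∂u₁ = X⁷ − 2u₁ − u₂²u₃`,
`∂h₁/∂u₂ = −2u₁u₂u₃ − 6u₂²(u₂³ − u₃²)`, `∂h₁/∂u₃ = −u₁u₂² + 4u₃(u₂³ − u₃²)` (`∂h₁/∂X = 7u₁X⁶ ≡ 0`) with `u₂ ≠ 2`
lies on the curve `Y = {(0, t², t³, t)}`: `Sing(𝒳₁) = Y` near `x₁`. [folklore] -/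
theorem sing_on_curve_seven_inE {K : Type*} [Field K] (h7 : (7 : K) = 0) (u₁ u₂ u₃ X : K) (hne : u₂ ≠ 2)
    (hh : u₁ * X ^ 7 - (u₁ ^ 2 + u₁ * u₂ ^ 2 * u₃ + (u₂ ^ 3 - u₃ ^ 2) ^ 2) = 0)
    (hd₁ : X ^ 7 - (2 * u₁ + u₂ ^ 2 * u₃) = 0)
    (hd₂ : -(2 * u₁ * u₂ * u₃) - 6 * u₂ ^ 2 * (u₂ ^ 3 - u₃ ^ 2) = 0)
    (hd₃ : -(u₁ * u₂ ^ 2) + 4 * u₃ * (u₂ ^ 3 - u₃ ^ 2) = 0) :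
    ∃ t : K, u₁ = 0 ∧ u₂ = t ^ 2 ∧ u₃ = t ^ 3 ∧ X = t := by
  have h2 : (2 : K) ≠ 0 := by
    intro h2; apply one_ne_zero (α := K); linear_combination h7 - 3 * h2
  have h4 : (4 : K) ≠ 0 := by
    intro h4; apply one_ne_zero (α := K); linear_combination (-1 : K) * h7 + 2 * h4
  have h2u₂ : u₂ - 2 ≠ 0 := sub_ne_zero.mpr hne
  have hsq : (u₂ ^ 3 - u₃ ^ 2 - u₁) * (u₂ ^ 3 - u₃ ^ 2 + u₁) = 0 := by
    linear_combination (-1 : K) * hh + u₁ * hd₁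
  have hu₁ : u₁ = 0 := by
    by_contra hne₁
    rcases mul_eq_zero.mp hsq with hA | hB
    · have e1 : 2 * u₁ * (u₂ * (u₃ + 3 * u₂)) = 0 := by
        linear_combination (-1 : K) * hd₂ - 6 * u₂ ^ 2 * hA
      have e2 : u₁ * (4 * u₃ - u₂ ^ 2) = 0 := by linear_combination hd₃ - 4 * u₃ * hA
      have f1 : u₂ * (u₃ + 3 * u₂) = 0 :=
        (mul_eq_zero.mp e1).resolve_left (mul_ne_zero h2 hne₁)
      have f2 : 4 * u₃ - u₂ ^ 2 = 0 := (mul_eq_zero.mp e2).resolve_left hne₁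
      have hu₂ : u₂ = 0 := by
        rcases mul_eq_zero.mp f1 with h0 | h3
        · exact h0
        · have e3 : u₂ * (u₂ - 2) = 0 := by
            linear_combination (-1 : K) * f2 + 4 * h3 - 2 * u₂ * h7
          exact (mul_eq_zero.mp e3).resolve_right h2u₂
      have hu₃ : u₃ = 0 := by
        have e4 : 4 * u₃ = 0 := by linear_combination f2 + (u₂) * hu₂
        exact (mul_eq_zero.mp e4).resolve_left h4
      exact hne₁ (by linear_combination (-1 : K) * hA + u₂ ^ 2 * hu₂ - u₃ * hu₃)
    · have e1 : 2 * u₁ * (u₂ * (u₃ - 3 * u₂)) = 0 := by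
        linear_combination (-1 : K) * hd₂ - 6 * u₂ ^ 2 * hB
      have e2 : u₁ * (4 * u₃ + u₂ ^ 2) = 0 := by linear_combination (-1 : K) * hd₃ + 4 * u₃ * hB
      have f1 : u₂ * (u₃ - 3 * u₂) = 0 :=
        (mul_eq_zero.mp e1).resolve_left (mul_ne_zero h2 hne₁)
      have f2 : 4 * u₃ + u₂ ^ 2 = 0 := (mul_eq_zero.mp e2).resolve_left hne₁
      have hu₂ : u₂ = 0 := by
        rcases mul_eq_zero.mp f1 with h0 | h3
        · exact h0
        · have e3 : u₂ * (u₂ - 2) = 0 := by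
            linear_combination f2 - 4 * h3 - 2 * u₂ * h7
          exact (mul_eq_zero.mp e3).resolve_right h2u₂
      have hu₃ : u₃ = 0 := by
        have e4 : 4 * u₃ = 0 := by linear_combination f2 - (u₂) * hu₂
        exact (mul_eq_zero.mp e4).resolve_left h4
      exact hne₁ (by linear_combination hB - u₂ ^ 2 * hu₂ + u₃ * hu₃)
  subst hu₁
  have hD2 : (u₂ ^ 3 - u₃ ^ 2) ^ 2 = 0 := by linear_combination (-1 : K) * hh
  have hcusp : u₃ ^ 2 = u₂ ^ 3 := by
    linear_combination (-1 : K) * ((pow_eq_zero_iff (two_ne_zero)).mp hD2)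
  obtain ⟨t, ht₂, ht₃⟩ := cusp_param u₂ u₃ hcusp
  refine ⟨t, rfl, ht₂, ht₃, ?_⟩
  subst ht₃ ht₂
  have hX : (X - t) ^ 7 = 0 := by
    linear_combination hd₁ +
      (-(X ^ 6 * t) + 3 * X ^ 5 * t ^ 2 - 5 * X ^ 4 * t ^ 3 + 5 * X ^ 3 * t ^ 4 - 3 * X ^ 2 * t ^ 5 + X * t ^ 6) * h7
  exact sub_eq_zero.mp ((pow_eq_zero_iff (by norm_num)).mp hX)

end Boundary

end Summit.ResolutionOfSingularities.ResolutionOfSingularities.Cruxes.DescentPerfectToAll.Lens5.QK1
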